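import Summits.ResolutionOfSingularities.ResolutionOfSingularities.Theorems.JetCutWideKernels2
import Summits.ResolutionOfSingularities.ResolutionOfSingularities.Theorems.JetCutBroadClasses
import HarnessLib

/-!
# JetCutBroadKernels2 — decomp-res node «JetCut» (lens-2 g15 rev 5), file 2/2 of `JetCutBroadKernels`

Content VERBATIM from the decomp-res lens-2 file `HOME/decomp-res-lens-2/g15/JetCut.lean` rev 5 (pin 9f53e5ca =
`parts/JetCut-rev5-9f53e5ca.lean`, 7 495 l;
HOME = run/shared/lean/pub/decomp-res; CRITIC-LEDGER rows 109 / 115 / 120 / 121 / 122 / 127 / 133 CLEARED; landing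
order INBOX :231; the critic's
HYGIENE-landing.md h1–h11 applied — DOCSTRING-ONLY).  The lens's blocks RESTATED VERBATIM from lens-2 g12 / g13 /
g14 (§R / §R13 / §R14) are DELETED:
they are the tree's `RelativeDeltaCut*` / `CurveLeafExit*` / `PinchCut*` modules (namespaces `RelativeDeltaCut`,
`CurveLeafExit`, `PinchCut`, opened;
the lens's `CurveLeafExitRestated.x` / `PinchCutRestated.x` are cited as `CurveLeafExit.x` / `PinchCut.x`, the three
pointwise engine edges of g12 as
`RelativeDeltaCut.x`).  Namespace `…Theorems.JetCut` (the lens's `Theses.JetCut` is gate-reserved), sub-namespaces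
`Tame` / `Wide` / `Broad` / `Vast`
as in the lens; file split only (tree files ≤ 400 lines): sections, variables and every declaration exactly as in
the lens, the long rev-0/1 prose
lives in HOME/decomp-res-lens-2/g15/NODE-g15.md §ARCHIVE-A (not in the tree).  Node files, in import order:
`JetCutJetKernels`, `JetCutPoint`, `JetCutClasses`, `JetCutKernels`, `JetCutTame`, `JetCutTameClasses`,
`JetCutTameKernels`, `JetCutLadder`, `JetCutWideClasses`, `JetCutWideKernels`, `JetCutMixed`, `JetCutBroadClasses`,
`JetCutBroadKernels`, `JetCutDegenerate`, `JetCutVastClasses`, `JetCutVastKernels`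
(each possibly continued `…2`, `…3`), then the wiring `MaxContactCutJetCut*` (in the Theses cone).  All `--supports
stmt-ResolutionOfSingularities-29273`
(`MaxContactCut.RungOne`); nothing closes 29273 — decided cells carry their engines as hypotheses, and exactly ONE
located-residual aside is booked on
the route for this column (`Vast.VastSpecialRung`, home `JetCutVastClasses`).

§MK (namespace `Broad`) + the route-free refinement edges broad → wide → tame → jet: pure-logic KERNELS of the BROAD
cut (mechanical copy of §K; EXACT `Broad.seqDimFour_one_iff`, `Broad.bGenRungAt_of_engines`,
`Broad.broadGenericRung_of_engines`) — VERBATIM, 0 sorry; `Broad.rungOne_iff` / `Broad.closes*` / edges naming route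
items are in `MaxContactCutJetCut*`.  [Writer: the lens's two mechanical re-proofs
`Broad.isCurveExitPt_of_isBroadCurvePt` / `Broad.not_isBroadSpecialPt_of_isBroadCurvePt` — the SAME statements as
the §M2 originals in the enclosing namespace — are not repeated (the gate's dedup.landed lint forbids restating a
landed declaration); every use resolves to the original by namespace resolution, proofs unchanged.]

Part 2/2 carries: `broadSpecialRung_of_wideSpecialRung`, `broadSpecialRung_of_tameSpecialRung`,
`broadSpecialRung_of_jetSpecialRung`, `wideGenericRung_of_broadGenericRung`, `tameGenericRung_of_broadGenericRung`.

(Sources: HunekeSwanson2006 Cor. 5.5.5; CossartJannsenSaito2020 Ch. 2, Thm. 3.6/3.7, Ch. 8; CossartPiltant2008 Prop.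
4.2; CossartPiltant2019 Rem. 3.2; Hironaka1964 Ch. III; Hironaka1967; Hironaka1977; Moh1987; Giraud1975.)
-/

open CategoryTheory AlgebraicGeometry TopologicalSpace IsLocalRing
open Literature.AlgebraicGeometry.Resolution
open Summit.ResolutionOfSingularities.ResolutionOfSingularities.Theorems
open Summit.ResolutionOfSingularities.ResolutionOfSingularities.Theorems.WeakOrderReduction
open Summit.ResolutionOfSingularities.ResolutionOfSingularities.Theorems.DeltaFaceCutClasses
open Summit.ResolutionOfSingularities.ResolutionOfSingularities.Theorems.RelativeDeltaCut
open Summit.ResolutionOfSingularities.ResolutionOfSingularities.Theorems.CurveLeafExit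
open Summit.ResolutionOfSingularities.ResolutionOfSingularities.Theorems.PinchCut

namespace Summit.ResolutionOfSingularities.ResolutionOfSingularities.Theorems.JetCut

namespace Broad

/-! ### Refinement edges of the broad cut to the wide cut (rev 3), the tame cut (rev 2) and the jet cut (rev 0) (BY NAME) -/

/-- The wide residual implies the broad residual (the residual SHRINKS again). [folklore] -/
theorem broadSpecialRung_of_wideSpecialRung (h : Wide.WideSpecialRung) : BroadSpecialRung := by
  intro hE2 n hn p hp k _ _ Y g h1 h2 h3 hY h4 I hord hex
  obtain ⟨y, hy, hs⟩ := hex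
  exact h hE2 n hn p hp k Y g h1 h2 h3 hY h4 I hord ⟨y, hy, isWideSpecialPt_of_isBroadSpecialPt hs⟩

/-- rev 2's residual implies the broad residual. [folklore] -/
theorem broadSpecialRung_of_tameSpecialRung (h : Tame.TameSpecialRung) : BroadSpecialRung :=
  broadSpecialRung_of_wideSpecialRung (Wide.wideSpecialRung_of_tameSpecialRung h)

/-- rev 0's residual implies the broad residual. [folklore] -/
theorem broadSpecialRung_of_jetSpecialRung (h : JetSpecialRung) : BroadSpecialRung :=
  broadSpecialRung_of_wideSpecialRung (Wide.wideSpecialRung_of_jetSpecialRung h)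

/-- The broad decided half implies the wide decided half. [folklore] -/
theorem wideGenericRung_of_broadGenericRung (h : BroadGenericRung) : Wide.WideGenericRung := by
  intro hE2 n hn p hp k _ _ Y g h1 h2 h3 hY h4 I hord hcls
  refine h hE2 n hn p hp k Y g h1 h2 h3 hY h4 I hord ?_
  intro y hy
  rcases hcls y hy with h' | h' | h' | h' | h' | h' | h' | h' | h'
  · exact Or.inl h'
  · exact Or.inr (Or.inl h')
  · exact Or.inr (Or.inr (Or.inl h'))
  · exact Or.inr (Or.inr (Or.inr (Or.inl h')))
  · exact Or.inr (Or.inr (Or.inr (Or.inr (Or.inl h'))))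
  · exact Or.inr (Or.inr (Or.inr (Or.inr (Or.inr (Or.inl h')))))
  · exact Or.inr (Or.inr (Or.inr (Or.inr (Or.inr (Or.inr (Or.inl h'))))))
  · exact Or.inr (Or.inr (Or.inr (Or.inr (Or.inr (Or.inr (Or.inr (Or.inl h')))))))
  · exact Or.inr (Or.inr (Or.inr (Or.inr (Or.inr (Or.inr (Or.inr (Or.inr (isBroadCurvePt_of_isWideCurvePt h'))))))))

/-- The broad decided half implies the tame decided half. [folklore] -/
theorem tameGenericRung_of_broadGenericRung (h : BroadGenericRung) : Tame.TameGenericRung :=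
  Wide.tameGenericRung_of_wideGenericRung (wideGenericRung_of_broadGenericRung h)

end Broad

end Summit.ResolutionOfSingularities.ResolutionOfSingularities.Theorems.JetCut
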